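import Summits.BirchSwinnertonDyer.BirchSwinnertonDyer.Theorems.ClassRecordThreeHalvesAtThreeNormContinuity
import Summits.BirchSwinnertonDyer.Rank1Residual.X2.CellCBDPValueLZZRoadInputOfFact
import Literature.NumberTheory.QuadraticFields.HeegnerCondition
import HarnessLib

/-!
# Route `ClassRecordThree` (cell `bsd-stepL`), crux (VC₃) `ValueContinuityAtThree` (item stmt-BirchSwinnertonDyer-19493): the
# NORM-ONE form (VC₃′) `ValueContinuityAtThreeNormOne` — VC₃'s text VERBATIM except that the unit is an element `u ∈ ℂ₃` with
# `‖u‖ = 1` instead of `u ∈ R₀ˣ` — PROVED from the REFEREED Liu–Zhang–Zhang fact (bsd-stepL plan g32 RULING 17 (C)(α) «GO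
# TODAY»; cross-cell supply from cell `bsd-eis`, seat `bsd-eis-cgshw` g15)

HONEST FRAMING (cells `bsd-stepL` / `bsd-eis`): ONE hypothesis-shaped `def` (VC₃′, the display statement; nothing asserted)
and theorems; nothing booked; O2 / B10 stay as labelled; no node, label or census count moves; BSD(E,3) is proved for no
class. The theorems are CONDITIONAL on `LiuZhangZhang2018.thm151_thm153_modularCurve_heegnerVector` (Liu–Zhang–Zhang, Duke
Math. J. 167 (2018) Thm. 1.5.1 + Remark 1.1.2 ∧ Thm. 1.5.3; REFEREED; typed p509230, readings audited pub/bsd-eis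
LIT-DOSSIER §82/§86) or on the typed input `X2.LZZRoadInputIoo` it implies (`X2.lzzRoadInputIoo_of_thm151_thm153`, p515022).

WHY (VC₃′) and not (VC₃): the supply `X2.exists_continuousDisplay_of_lzzRoadInputIoo` (pub/bsd-eis cgshw MEMO-18 §5, 399 l.)
exports its unit as `u : ℂ_p` with `‖u‖ = 1`; from the typed input alone `u ∈ R₀` does not follow (the input's χ-independent
constant is only of norm one); frame-free membership `u ∈ R₀ˣ` is the (β) skeleton of 19493 (`√|d_K| ∈ R₀` by Gauss sums +
a FACT-level unit export). Downstream nothing is lost: (VC₃′) ⟹ (VN₃) (take norms) ⟹ `Three.BDPValueAt₃ W`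
(`bdpValueAt₃_of_normContinuity`) — see `ClassRecordThreeBDPValueLeafOfLZZ.lean` (p522944), whose leaf theorem is re-derived
here from (VC₃′) as a check of the plumbing. 19493 itself is NOT re-cut (RULING 17 (C): its glue 19495 is closed).

* `ValueContinuityAtThreeNormOne` — (VC₃′), VC₃'s text with `∃ (ΩK : ℂ) (Ωp u : ℂ_[3]), ΩK ≠ 0 ∧ Ωp ≠ 0 ∧ ‖u‖ = 1 ∧ …`;
* `valueContinuityAtThreeNormOne_of_lzzRoadInputIoo`, **`valueContinuityAtThreeNormOne_of_thm151_thm153`**;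
* `normContinuity₃_of_valueContinuityAtThreeNormOne` ((VC₃′) ⟹ (VN₃) at every curve), `bdpValueLeafAtThree_of_valueContinuityAtThreeNormOne`.

References: [LiuZhangZhang2018] Duke Math. J. 167 (2018) Thm. 1.5.1, Remark 1.1.2, Thm. 1.5.3, Assumption 1.8.1 (pp. 745–751);
[BertoliniDarmonPrasanna2013] Thm. 5.13, [CastellaHsieh2018] Prop. 3.6, [Castella2018] Thm. 3.1–3.2, [Castella2018Exceptional]
Thms. 2.10–2.11 (the shapes VC₃ cites; nothing of them asserted here); pub/bsd-eis/cgshw-MEMO-18 and MEMO-19, k5-c4-MEMO-5.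
-/

set_option linter.dupNamespace false

noncomputable section

open scoped Classical Topology

open Filter WeierstrassCurve NumberField IsDedekindDomain Field PowerSeries
  Literature.NumberTheory.EllipticCurves Literature.NumberTheory.EllipticCurves.ModularForms
  Literature.NumberTheory.EllipticCurves.Rank1Residual
  Literature.NumberTheory.GaloisRepresentations Literature.NumberTheory.GaloisCohomology
  Summit.BirchSwinnertonDyer.Rank1Residual Summit.BirchSwinnertonDyer.Rank1Residual.X11b
  Summit.BirchSwinnertonDyer.Rank1Residual.X11b.AcSelmer
  Summit.BirchSwinnertonDyer.Rank1Residual.X11b.CongruenceLimit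
  Summit.BirchSwinnertonDyer.Rank1Residual.X11b.Halves
  Summit.BirchSwinnertonDyer.Rank1Residual.X11b.Three
  Summit.BirchSwinnertonDyer.BirchSwinnertonDyer.Theses.ClassRecordThree

namespace Summit.BirchSwinnertonDyer.BirchSwinnertonDyer.Theorems

/-! ## §1 The statement (VC₃′) -/

/-- **(VC₃′) `ValueContinuityAtThreeNormOne`** — the route crux `ClassRecordThree.ValueContinuityAtThree` (item 19493, VC₃:
value continuity of Castella's BDP display at the trivial character, class-wide on X11b@3 ∧ Surj) VERBATIM except that the
unit is `u : ℂ_[3]` with `‖u‖ = 1` instead of `u : (unrIntegers 3)ˣ`. A statement (`Prop`), hypothesis-shaped; nothing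
asserted by the definition; NOT a Literature fact and not claimed printed in this form (a cell-posited statement like VC₃
itself; its PROOF below rests on the refereed Liu–Zhang–Zhang theorem, cited on the theorems). -/
def ValueContinuityAtThreeNormOne : Prop :=
  ∀ (W : WeierstrassCurve ℚ) [W.IsElliptic] [W.IsGloballyMinimal], ∀ (N : ℕ) [NeZero N] (K : Type) [Field K]
    [NumberField K] (Dt : Literature.NumberTheory.EllipticCurves.ModularForms.ModularParametrizationData W N) (H :
    Literature.NumberTheory.EllipticCurves.HeegnerDatum N (NumberField.discr K)) (ι : K →+* ℂ) (P : (W.baseChange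
    K).toAffine.Point), Summit.BirchSwinnertonDyer.Rank1Residual.ClassX11b W 3 →
    Literature.NumberTheory.EllipticCurves.Rank1Residual.Surj W 3 → W.conductorNorm ℤ = N →
    Literature.NumberTheory.EllipticCurves.IsImaginaryQuadratic K → Odd (NumberField.discr K) →
    Literature.NumberTheory.EllipticCurves.SatisfiesHeegnerHypothesis N K → (W.quadraticTwist (NumberField.discr K :
    ℚ)).entireLFunction 1 ≠ 0 → WeierstrassCurve.Affine.Point.map ι.toRatAlgHom P =
    Literature.NumberTheory.EllipticCurves.ModularForms.heegnerPointComplex Dt H → ¬ (3 : ℤ) ∣ Dt.c → ¬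
    IsOfFinAddOrder P → ∀ (κ : Literature.NumberTheory.EllipticCurves.ZpExtension K 3), κ.IsAnticyclotomic → ∀ (γ :
    Field.absoluteGaloisGroup K) [Fact (κ.IsTopGenerator γ)] (𝔭 : IsDedekindDomain.HeightOneSpectrum
    (NumberField.RingOfIntegers K)) (h𝔭 : ((3 : ℕ) : NumberField.RingOfIntegers K) ∈ 𝔭.asIdeal) (he :
    𝔭.asIdeal.ramificationIdx (NumberField.RingOfIntegers ℚ) = 1) (hf : 𝔭.asIdeal.inertiaDeg
    (NumberField.RingOfIntegers ℚ) = 1), ∀ (f : CuspForm (CongruenceSubgroup.Gamma0 N) 2),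
    Literature.NumberTheory.EllipticCurves.ModularForms.IsNewformOf W f → ∀ (ι' : PadicAlgCl 3 ≃+* ℂ),
    Summit.BirchSwinnertonDyer.Rank1Residual.X11b.Three.InducesPrime ι' 𝔭 → ∃ (ΩK : ℂ) (Ωp u : ℂ_[3]), ΩK ≠ 0 ∧ Ωp ≠
    0 ∧ ‖u‖ = 1 ∧ ∀ (φ : ℕ → Literature.NumberTheory.GaloisRepresentations.HeckeCharacter K) (n : ℕ → ℕ) (r : ℕ →
    Literature.NumberTheory.GaloisRepresentations.FramedGaloisRep K (PadicAlgCl 3) 1), (∀ k, 0 < n k) → (∀ k (v :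
    IsDedekindDomain.HeightOneSpectrum (NumberField.RingOfIntegers K)), (φ k).IsUnramifiedAt v) → (∀ k, (φ
    k).HasInfinityType (fun _ ↦ (n k : ℤ)) (fun _ ↦ -(n k : ℤ))) → (∀ k,
    Literature.NumberTheory.EllipticCurves.IsPAdicAvatarOf ι' (φ k) (r k)) → (∀ k,
    Literature.NumberTheory.EllipticCurves.FactorsThroughZp κ (r k)) → Filter.Tendsto (fun k ↦
    Literature.NumberTheory.EllipticCurves.avatarValueAt (r k) γ) Filter.atTop (nhds 1) → Filter.Tendsto (fun k ↦
    ((ι'.symm (Literature.NumberTheory.EllipticCurves.bdpInterpolationValue 3 f 𝔭 (φ k) (n k) ΩK) : PadicAlgCl 3) :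
    ℂ_[3]) * Ωp ^ (4 * n k)) Filter.atTop (nhds (u * (algebraMap ℚ_[3] ℂ_[3] (((1 : ℚ_[3]) - ((W.LFunction 3 : ℤ) :
    ℚ_[3]) * (3 : ℚ_[3])⁻¹) * Summit.BirchSwinnertonDyer.Rank1Residual.X11b.Halves.logOmega W 3
    (Summit.BirchSwinnertonDyer.Rank1Residual.X11b.embAt K 3 𝔭 h𝔭 he hf) P)) ^ 2))

/-! ## §2 (VC₃′) from the typed LZZ input / from the REFEREED fact -/

/-- **(VC₃′) from the typed Liu–Zhang–Zhang input `X2.LZZRoadInputIoo`**: at each datum apply the bsd-eis rescale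
`X2.exists_continuousDisplay_of_lzzRoadInputIoo` (no reducibility / image / rank hypothesis) with `e := embAt K 3 𝔭`;
dictionary: Mult ⟸ `ClassX11b`, `3 ∣ N` / `9 ∤ N` ⟸ Mult, `3` split ⟸ Heegner for `N`, `d_K < −4` ⟸ `Odd d_K` ∧ `3 ∤ d_K`
(`not_dvd_discr`) ∧ Stickelberger ∧ `d_K < 0`, `InducesPrime` verbatim, `logOmega = padicLogOmega`. CONDITIONAL on the
typed input; nothing booked. [cite: LiuZhangZhang2018, Thm. 1.5.1 and Thm. 1.5.3 (Duke 167 pp. 748–749) (source of the input; nothing asserted)] -/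
theorem valueContinuityAtThreeNormOne_of_lzzRoadInputIoo (hL : X2.LZZRoadInputIoo) : ValueContinuityAtThreeNormOne := by
  intro W _ _ N _ K _ _ Dt H ι P hX _hsurj hN hK hodd hHN _hLt hP hcM _hPinf κ hκ γ hγ 𝔭 h𝔭 he hf f hfW ι' hι'
  have hp : (3 : ℕ).Prime := Fact.out
  have hmult : W.HasMultiplicativeReductionAtPrime 3 := hX.2.2.1
  have hpN : 3 ∣ N := hN ▸ X11b.dvd_conductorNorm_of_mult (W := W) hmult
  have hp2N : ¬ 3 ^ 2 ∣ N := hN ▸ X2.not_sq_dvd_conductorNorm_of_mult W 3 hmult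
  have hsplit : ((Ideal.span {((3 : ℕ) : ℤ)}).primesOver (𝓞 K)).ncard = 2 := hHN 3 hp hpN
  have hdisc : ¬ ((3 : ℕ) : ℤ) ∣ NumberField.discr K :=
    Literature.SatisfiesHeegnerHypothesis.not_dvd_discr hK.1 hHN hp hpN
  have hneg : NumberField.discr K < 0 := IsImaginaryQuadratic.discr_neg hK
  have hmod4 := Literature.NumberTheory.QuadraticFields.Quadratic.discr_emod_four (K := K) hK.1
  have hd4 : NumberField.discr K < -4 := by
    obtain ⟨m, hm⟩ := hodd
    have h3 : NumberField.discr K ≠ -3 := fun h ↦ hdisc ⟨-1, by rw [h]; norm_num⟩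
    omega
  have hemb : ∀ k : 𝓞 K, k ∈ 𝔭.asIdeal ↔ ‖embAt K 3 𝔭 h𝔭 he hf (k : K)‖ < 1 :=
    mem_asIdeal_iff_norm_embAt_lt_one 𝔭 h𝔭 he hf
  obtain ⟨ΩK, Ωp, u, hΩK, hΩp, hu, hcont⟩ :=
    X2.exists_continuousDisplay_of_lzzRoadInputIoo hL ι' W K 𝔭 κ γ Dt H ι (embAt K 3 𝔭 h𝔭 he hf) P f
      (by decide) hmult hN hpN hp2N hK hd4 hsplit h𝔭 hι' hHN hκ hγ.out hfW hcM hP hemb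
  refine ⟨ΩK, Ωp, u, hΩK, hΩp, hu, fun φ n r hn hunr hinf hav hfac hlim ↦ ?_⟩
  have h := hcont φ n r hn hunr hinf hav hfac hlim
  rwa [← R1.logOmega_eq_padicLogOmega] at h

/-- **(VC₃′) from the REFEREED Liu–Zhang–Zhang fact** (Duke 167 Thm. 1.5.1 ∧ 1.5.3 at `3 ∥ N`, typed p509230) through the
bsd-eis glue `X2.lzzRoadInputIoo_of_thm151_thm153` (p515022) — the by-name PUB support of crux 19493 asked for in RULING 17
(C)(α). A `conditional-result` (hypothesis = a Literature named fact); nothing booked; no label or count moves.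
[cite: LiuZhangZhang2018, Thm. 1.5.1 and Remark 1.1.2 and Thm. 1.5.3 (Duke Math. J. 167 (2018) pp. 745–749)] -/
theorem valueContinuityAtThreeNormOne_of_thm151_thm153
    (hF : LiuZhangZhang2018.thm151_thm153_modularCurve_heegnerVector) : ValueContinuityAtThreeNormOne :=
  valueContinuityAtThreeNormOne_of_lzzRoadInputIoo (X2.lzzRoadInputIoo_of_thm151_thm153 hF)

/-! ## §3 (VC₃′) ⟹ (VN₃) ⟹ the H2 leaf (plumbing check against p522944's consumer) -/

/-- **(VC₃′) ⟹ (VN₃) at every curve** (take norms; `‖u‖ = 1`) — the hypothesis shape of `bdpValueAt₃_of_normContinuity`.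
[folklore] -/
theorem normContinuity₃_of_valueContinuityAtThreeNormOne (hVC : ValueContinuityAtThreeNormOne)
    (W : WeierstrassCurve ℚ) [W.IsElliptic] [W.IsGloballyMinimal] :
    ∀ (N : ℕ) [NeZero N] (K : Type) [Field K] [NumberField K] (Dt : ModularParametrizationData W N)
      (H : HeegnerDatum N (NumberField.discr K)) (ι : K →+* ℂ) (P : (W.baseChange K).toAffine.Point),
      ClassX11b W 3 → Surj W 3 → W.conductorNorm ℤ = N → IsImaginaryQuadratic K →
      Odd (NumberField.discr K) → SatisfiesHeegnerHypothesis N K →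
      (W.quadraticTwist (NumberField.discr K : ℚ)).entireLFunction 1 ≠ 0 →
      WeierstrassCurve.Affine.Point.map ι.toRatAlgHom P = heegnerPointComplex Dt H →
      ¬ (3 : ℤ) ∣ Dt.c → ¬ IsOfFinAddOrder P →
      ∀ (κ : ZpExtension K 3), κ.IsAnticyclotomic →
        ∀ (γ : Field.absoluteGaloisGroup K) [Fact (κ.IsTopGenerator γ)]
          (𝔭 : HeightOneSpectrum (𝓞 K)) (h𝔭 : ((3 : ℕ) : 𝓞 K) ∈ 𝔭.asIdeal)
          (he : 𝔭.asIdeal.ramificationIdx (𝓞 ℚ) = 1) (hf : 𝔭.asIdeal.inertiaDeg (𝓞 ℚ) = 1),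
          ∀ (f : CuspForm (CongruenceSubgroup.Gamma0 N) 2), IsNewformOf W f →
            ∀ (ι' : PadicAlgCl 3 ≃+* ℂ), InducesPrime ι' 𝔭 →
              ∃ (ΩK : ℂ) (Ωp : ℂ_[3]), ΩK ≠ 0 ∧ Ωp ≠ 0 ∧
                ∀ (φ : ℕ → HeckeCharacter K) (n : ℕ → ℕ) (r : ℕ → FramedGaloisRep K (PadicAlgCl 3) 1),
                  (∀ k, 0 < n k) → (∀ k (v : HeightOneSpectrum (𝓞 K)), (φ k).IsUnramifiedAt v) →
                  (∀ k, (φ k).HasInfinityType (fun _ ↦ (n k : ℤ)) (fun _ ↦ -(n k : ℤ))) →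
                  (∀ k, IsPAdicAvatarOf ι' (φ k) (r k)) → (∀ k, FactorsThroughZp κ (r k)) →
                  Tendsto (fun k ↦ avatarValueAt (r k) γ) atTop (𝓝 1) →
                  Tendsto (fun k ↦ ‖((ι'.symm (bdpInterpolationValue 3 f 𝔭 (φ k) (n k) ΩK) :
                    PadicAlgCl 3) : ℂ_[3]) * Ωp ^ (4 * n k)‖) atTop
                    (𝓝 (‖algebraMap ℚ_[3] ℂ_[3] (((1 : ℚ_[3]) - ((W.LFunction 3 : ℤ) : ℚ_[3]) *
                        (3 : ℚ_[3])⁻¹) * logOmega W 3 (embAt K 3 𝔭 h𝔭 he hf) P)‖ ^ 2)) := by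
  intro N _ K _ _ Dt H ι P hX hsurj hN hK hodd hHN hLt hP hcM hPinf κ hκ γ hγ 𝔭 h𝔭 he hf f hfW ι' hι'
  obtain ⟨ΩK, Ωp, u, hΩK, hΩp, hu, hcont⟩ :=
    hVC W N K Dt H ι P hX hsurj hN hK hodd hHN hLt hP hcM hPinf κ hκ γ 𝔭 h𝔭 he hf f hfW ι' hι'
  refine ⟨ΩK, Ωp, hΩK, hΩp, fun φ n r hn hunr hinf hav hfac hlim ↦ ?_⟩
  have h := (hcont φ n r hn hunr hinf hav hfac hlim).norm
  rwa [norm_mul, hu, one_mul, norm_pow] at h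

/-- **(VC₃′) ⟹ the route leaf `BDPValueLeafAtThree`** (item 19406), via `classRecordThree_bdpValueLeafAtThree_of_normContinuity`
— so `bdpValueLeafAtThree_of_thm151_thm153` (p522944) also factors through (VC₃′). CONDITIONAL on (VC₃′); nothing booked.
[cite: Castella2018, Thm. 3.1–3.2 (arXiv:1704.06608 pp. 8–9) (display shape only; nothing asserted at p = 3)] -/
theorem bdpValueLeafAtThree_of_valueContinuityAtThreeNormOne (hVC : ValueContinuityAtThreeNormOne) :
    BDPValueLeafAtThree :=
  classRecordThree_bdpValueLeafAtThree_of_normContinuity fun W _ _ ↦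
    normContinuity₃_of_valueContinuityAtThreeNormOne hVC W

end Summit.BirchSwinnertonDyer.BirchSwinnertonDyer.Theorems

end
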